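import Summits.BirchSwinnertonDyer.BirchSwinnertonDyer.Theses.TorsionLayerDescent
import Summits.BirchSwinnertonDyer.BirchSwinnertonDyer.Theorems.TorsionLayerDescentRungLocalized
import HarnessLib

/-!
# Crux `HowardContainmentAnyClassNumber` (stmt-23161; deciding transport `…OfPrint` stmt-25546) — line artefact
`Lines/rung_localized.lean`: the LEVER-REGIME rungs, BY NAME (pointer file, no new mathematics)

The rungs live in the landed route-free Theorems file
`Summits/BirchSwinnertonDyer/BirchSwinnertonDyer/Theorems/TorsionLayerDescentRungLocalized.lean` (p611135,
trib-w-tld g3, `--supports stmt-BirchSwinnertonDyer-25546`; namespace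
`Summit.BirchSwinnertonDyer.BirchSwinnertonDyer.Theorems.TorsionLayerDescentRung`). This file only re-exports
them under the crux directory so that `ledger crux ls stmt-BirchSwinnertonDyer-23161` shows the lever side next
to `Lines/rung.lean` (the printed-regime slice `rung_coprimeClassNumber`, p607032) — the kernel re-checks here
that each landed declaration has the advertised type over the route's OWN binders
(`Theses.TorsionLayerDescent.CGLSHowardDivisibilityLocalized` = stmt-25234,
`Theses.TorsionLayerDescent.AnticyclotomicTowerInRingClassFields` = stmt-25236,
`Theses.TorsionLayerDescent.MastellaZermanHowardDivisibility` = stmt-25233).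

HONEST LABEL (verbatim from the Theorems file): PRINT modulo typing (CGLS 2022 Thm. 4.1.3 + Cor. 3.4.2 +
Rem. 4.1.4 via `hCGLS`; tower fact via `hTw`); LEVER REGIME typed (no class-number hypothesis; `p ∣ h_K`;
torsion depth `δ ≥ 1` with `0 < C.depth` certified); LOCALIZED at `p` and stated for CGLS's stabilised module
`Λκ_∞(C)`, not Howard's `ℋ_F` — integral promotion and envelope are the open residual (line stubs s_mu / s_env),
beyond print, untouched. «beyond-print theorem»: no. BSD / `BSD_p` on X9 / crux A: NOT proved.
Memo: `Lines/rung-addendum-g3.md`. [cite: CastellaGrossiLeeSkinner2022, Thm. 4.1.3, Cor. 3.4.2, Rem. 4.1.4 (arXiv:2008.02571)]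
-/

set_option autoImplicit false
set_option linter.dupNamespace false

namespace Summit.BirchSwinnertonDyer.BirchSwinnertonDyer.Cruxes.HowardContainmentAnyClassNumber.RungLocalized

open Summit.BirchSwinnertonDyer.BirchSwinnertonDyer.Theorems

/-- CGLS's standing hypotheses on a frame of crux A's letter with `d_K` odd (no class-number input). -/
alias thm413Hypotheses_of_frame := TorsionLayerDescentRung.thm413Hypotheses_of_frame

/-- At a GIVEN `jbar`: tied, depth-typed stabilised datum with the `Λ[1/p,1/T]` containment and, at Selmer
corank one, the `Λ[1/p]` containment — every class number (from `hCGLS`, `hTw` by ID). -/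
alias stabilizedContainmentAt_tied := TorsionLayerDescentRung.stabilizedContainmentAt_tied

/-- Rung in A's `∃ jbar` letter, `Λ[1/p,1/T]`, frame + `d_K` odd only, every class number. -/
alias rung_pTLocalized_anyClassNumber := TorsionLayerDescentRung.rung_pTLocalized_anyClassNumber

/-- Rung in A's `∃ jbar` letter, `Λ[1/p]`, + `rank E(K) = 1`, `Ш[p^∞]` finite, every class number. -/
alias rung_localized_anyClassNumber := TorsionLayerDescentRung.rung_localized_anyClassNumber

/-- LEVER REGIME `p ∣ h_K` explicit (complement of the printed regime of `rung_coprimeClassNumber`). -/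
alias rung_localized_divisibleClassNumber := TorsionLayerDescentRung.rung_localized_divisibleClassNumber

/-- LEVER REGIME, first torsion layer typed (`ringClassSubgroup K 1 jbar ≤ κ.layerSubgroup 1`), produced
datum's depth certified positive (`0 < C.depth`), `Λ[1/p]` containment at Selmer corank one. -/
alias rung_depthPos_localized := TorsionLayerDescentRung.rung_depthPos_localized

/-- LEVER REGIME, `δ ≥ 1`, `Λ[1/p,1/T]`, no rank/`Ш` hypothesis — the registered stub
`TorsionDepth.Stmt.stub_depthPos_localized`'s spelling with the three stated differences. -/
alias rung_depthPos_pTLocalized := TorsionLayerDescentRung.rung_depthPos_pTLocalized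

/-- Both regimes of the deciding crux side by side from its THREE print binders. -/
alias rung_twoRegimes_localized := TorsionLayerDescentRung.rung_twoRegimes_localized

/-- Kernel re-check of the headline type over the route's own binders (by ID): the lever rung is a function of
`hCGLS` (stmt-25234) and `hTw` (stmt-25236) alone. -/
example (hCGLS : Theses.TorsionLayerDescent.CGLSHowardDivisibilityLocalized)
    (hTw : Theses.TorsionLayerDescent.AnticyclotomicTowerInRingClassFields) :=
  TorsionLayerDescentRung.rung_depthPos_localized hCGLS hTw

end Summit.BirchSwinnertonDyer.BirchSwinnertonDyer.Cruxes.HowardContainmentAnyClassNumber.RungLocalized
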